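import Summits.BirchSwinnertonDyer.Rank1Residual.Additive.ClassicalConditionAwayBadPlaces
import Summits.BirchSwinnertonDyer.Rank1Residual.X2.GreenbergVatsalSelmerEquality
import Summits.BirchSwinnertonDyer.Rank1Residual.X2.GreenbergVatsalTateDatumCofree
import Literature.NumberTheory.EllipticCurves.GreenbergVatsal2000.NonPrimitiveSelmerGroup
import HarnessLib

/-!
# `Sel^{Σ₀}_E(K_∞)_p = S^{Σ₀}_{E[p^∞]}(K_∞)` with the BAD places `v ∤ p` OUTSIDE `Σ₀` allowed — in
# particular `Σ₀ = ∅`: `Sel_E(K_∞)_p = S_A(K_∞)` (cell `b2b-bsdres`, team n1011, seat p06 GEN 5;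
# OWNERS row T-A240-PORT, item K1′ — the subgroup equalities that K1's
# `DatumDualData.ofNonPrimitive` / `.ofSelmer` (shape (α), p12 GEN 6's word) take as their
# hypothesis `h`)

HONEST FRAMING (cell `b2b-bsdres`, run/shared/lean/b2b/bsd-rank1-residual/, verbatim in every
file): the goal of the cell is to DELETE the COMBINATION-SHAPED residual classes of the
Birch–Swinnerton-Dyer formula for ALL analytic-rank `≤ 1` elliptic curves over `ℚ` — "full BSD
formula for every rank `≤ 1` curve in class `C`" assembled STRICTLY from published theorems — so
that the rank-`≤ 1` remainder becomes exactly the CONSTRUCTION-SHAPED classes, which are TYPED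
(missing-input `Prop`s), NOT attempted. This is not "finishing BSD". Team n1011: research routes on
CONSTRUCTION-SHAPED classes (ARM α / A240 discharge); census output = EVIDENCE, never a Literature
fact; RESIDUAL-MAP marks UNCHANGED; nothing is booked by this file. THEOREMS ONLY: no definition,
no named fact.

## What and why

seat p12's `nonPrimitiveSelmerInfty_eq_gvSelmerInfty_of_greenbergKer_eq` (FILE 3 of row
T-E3g-GV29o, over `ℚ`) proves `Sel^{Σ₀}_E(ℚ_∞)_p = S^{Σ₀}_{E[p^∞]}(ℚ_∞)` for Greenberg data with
the R-D identity at `p`, under `hS : E good outside Σ₀ ∪ {p}` — the comparison of the two local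
conditions at `v ∤ p` was available at GOOD places only.  With this seat's LINK at the bad places
(`UnramifiedAwayBadPlaces` p287268 + `ClassicalConditionAwayBadPlaces` p287807: over `K_∞`,
classical = locally trivial = unramified at EVERY `v ∤ p`), `hS` is DROPPED:

* `nonPrimitiveSelmerInfty_eq_gvSelmerInfty` — any number field `K : Type`, `p` odd, `κ`
  cyclotomic, ANY elliptic curve, Greenberg data `L` with the R-D identity
  `(L v).greenbergKer (ker κ) = localKerOver` at every `v ∣ p` (hypothesis `hRD`, discharged on
  the loci elsewhere), `Σ₀ ∌ v ∣ p`: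
  `nonPrimitiveSelmerInfty W κ Σ₀ = gvSelmerInfty κ E[p^∞] L Σ₀`;
* `selmerInfty_eq_gvSelmerInfty` — the case `Σ₀ = ∅`: `Sel_E(K_∞)_p = S_{E[p^∞]}(K_∞)`
  (`W.selmerInfty κ = gvSelmerInfty κ E[p^∞] L ∅`);
* `…_eq_datumSelmerInfty` forms (the Literature name, `X2.GreenbergVatsalTateDatumCofree` bridge).

References: Greenberg–Vatsal 2000 §2 pp. 17, 20, 26 [GreenbergVatsal2000]; Greenberg LNM 1716 §2
pp. 69–75 [GreenbergLNM1716].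
-/

set_option autoImplicit false

noncomputable section

open scoped Classical

namespace Summit.BirchSwinnertonDyer.Rank1Residual.Additive

open NumberField IsDedekindDomain Field WeierstrassCurve
  Literature.NumberTheory.GaloisRepresentations Literature.NumberTheory.EllipticCurves
  Literature.NumberTheory.EllipticCurves.GreenbergSelmer
  Literature.NumberTheory.EllipticCurves.GreenbergVatsal2000
  Summit.BirchSwinnertonDyer.Rank1Residual.X2.GreenbergVatsalTorsion
  Summit.BirchSwinnertonDyer.Rank1Residual.X2.GreenbergVatsalSelmerEquality
  Summit.BirchSwinnertonDyer.Rank1Residual.X2.GreenbergVatsalUnramifiedAway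

variable {K : Type} [Field K] [NumberField K] (W : WeierstrassCurve K) [W.IsElliptic] (p : ℕ)
  [hp : Fact p.Prime] (κ : ZpExtension K p) (S₀ : Set (HeightOneSpectrum (𝓞 K)))

/-- **`Sel^{Σ₀}_E(K_∞)_p = S^{Σ₀}_{E[p^∞]}(K_∞)` — bad places outside `Σ₀` allowed.** `p` odd, `κ`
cyclotomic, `L` Greenberg data above `p` with the R-D identity `(L v).greenbergKer (ker κ) =
localKerOver` at every `v ∣ p`, `Σ₀ ∌ v ∣ p`; NO reduction hypothesis anywhere (p12's FILE 3 minus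
`hS`): at `v ∉ Σ₀`, `v ∤ p` the two conditions agree by the LINK (`localKerOver_le_unramKer`,
`unramKer_le_localKerOver_of_isCyclotomic`), at `v ∣ p` by `hRD`, at `∞` both are empty for `p` odd.
[cite: GreenbergVatsal2000, §2 pp. 17, 26] [cite: GreenbergLNM1716, §2 pp. 69–75] -/
theorem nonPrimitiveSelmerInfty_eq_gvSelmerInfty (hp2 : p ≠ 2) (hκ : κ.IsCyclotomic)
    (L : Data K (W.geomPrimaryTorsion p) p)
    (hRD : ∀ (v : HeightOneSpectrum (𝓞 K)) (hv : ((p : ℕ) : 𝓞 K) ∈ v.asIdeal),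
      (L v hv).greenbergKer κ.kerSubgroup = W.localKerOver p κ.kerSubgroup (v.adicCompletion K))
    (hS₀ : ∀ v ∈ S₀, ((p : ℕ) : 𝓞 K) ∉ v.asIdeal) :
    nonPrimitiveSelmerInfty W κ S₀ = gvSelmerInfty κ (W.geomPrimaryTorsion p) L S₀ := by
  apply le_antisymm
  · intro c hc
    have hc' : c ∈ nonPrimitiveSelmerGroupOver W p κ.kerSubgroup S₀ := hc
    rw [mem_nonPrimitiveSelmerGroupOver_iff] at hc'
    change c ∈ gvSelmer κ.kerSubgroup (W.geomPrimaryTorsion p) p L S₀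
    rw [mem_gvSelmer_iff]
    refine ⟨fun v hv hpv σ ↦ localKerOver_le_unramKer (κ := κ) (v := v) (W := W) (p := p) hpv
      (hc'.1 v hv σ), fun v hv σ ↦ ?_⟩
    rw [hRD v hv]
    exact hc'.1 v (fun hvS ↦ hS₀ v hvS hv) σ
  · intro c hgv
    change c ∈ nonPrimitiveSelmerGroupOver W p κ.kerSubgroup S₀
    rw [mem_nonPrimitiveSelmerGroupOver_iff]
    refine ⟨fun v hvS σ ↦ ?_, fun w σ ↦ ?_⟩
    · by_cases hpv : ((p : ℕ) : 𝓞 K) ∈ v.asIdeal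
      · rw [← hRD v hpv]
        exact ((mem_gvSelmer_iff c).1 hgv).2 v hpv σ
      · exact unramKer_le_localKerOver_of_isCyclotomic (κ := κ) (v := v) (W := W) (p := p) hκ hpv
          (((mem_gvSelmer_iff c).1 hgv).1 v hvS hpv σ)
    · rw [localKerOver_completion_eq_top_of_odd W p hp2]
      exact AddSubgroup.mem_top _

/-- **`Sel_E(K_∞)_p = S_{E[p^∞]}(K_∞)` (`Σ₀ = ∅`)** — `p` odd, `κ` cyclotomic, ANY elliptic curve,
data with the R-D identity at `p`. [cite: GreenbergVatsal2000, §2 pp. 17, 26]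
[cite: GreenbergLNM1716, §2 Prop. 2.1, pp. 69–75] -/
theorem selmerInfty_eq_gvSelmerInfty (hp2 : p ≠ 2) (hκ : κ.IsCyclotomic)
    (L : Data K (W.geomPrimaryTorsion p) p)
    (hRD : ∀ (v : HeightOneSpectrum (𝓞 K)) (hv : ((p : ℕ) : 𝓞 K) ∈ v.asIdeal),
      (L v hv).greenbergKer κ.kerSubgroup = W.localKerOver p κ.kerSubgroup (v.adicCompletion K)) :
    W.selmerInfty κ = gvSelmerInfty κ (W.geomPrimaryTorsion p) L ∅ := by
  rw [← nonPrimitiveSelmerInfty_eq_gvSelmerInfty W p κ ∅ hp2 hκ L hRD (fun _ h ↦ h.elim)]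
  change W.selmerGroupOver p κ.kerSubgroup = nonPrimitiveSelmerGroupOver W p κ.kerSubgroup ∅
  rw [nonPrimitiveSelmerGroupOver_empty]

/-- **`Sel^{Σ₀}_E(K_∞)_p = S^{Σ₀}_{E[p^∞]}(K_∞)` in the Literature name `datumSelmerInfty`** (the
hypothesis `h` of K1's `DatumDualData.ofNonPrimitive`).
[cite: GreenbergVatsal2000, §2 pp. 17, 20] -/
theorem nonPrimitiveSelmerInfty_eq_datumSelmerInfty (hp2 : p ≠ 2) (hκ : κ.IsCyclotomic)
    (L : Data K (W.geomPrimaryTorsion p) p)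
    (hRD : ∀ (v : HeightOneSpectrum (𝓞 K)) (hv : ((p : ℕ) : 𝓞 K) ∈ v.asIdeal),
      (L v hv).greenbergKer κ.kerSubgroup = W.localKerOver p κ.kerSubgroup (v.adicCompletion K))
    (hS₀ : ∀ v ∈ S₀, ((p : ℕ) : 𝓞 K) ∉ v.asIdeal) :
    nonPrimitiveSelmerInfty W κ S₀ = datumSelmerInfty κ (W.geomPrimaryTorsion p) L S₀ := by
  rw [nonPrimitiveSelmerInfty_eq_gvSelmerInfty W p κ S₀ hp2 hκ L hRD hS₀]
  rfl

/-- **`Sel_E(K_∞)_p = S_{E[p^∞]}(K_∞)` in the Literature name `datumSelmerInfty … ∅`** (the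
hypothesis `h` of K1's `DatumDualData.ofSelmer`). [cite: GreenbergVatsal2000, §2 pp. 17, 20] -/
theorem selmerInfty_eq_datumSelmerInfty (hp2 : p ≠ 2) (hκ : κ.IsCyclotomic)
    (L : Data K (W.geomPrimaryTorsion p) p)
    (hRD : ∀ (v : HeightOneSpectrum (𝓞 K)) (hv : ((p : ℕ) : 𝓞 K) ∈ v.asIdeal),
      (L v hv).greenbergKer κ.kerSubgroup = W.localKerOver p κ.kerSubgroup (v.adicCompletion K)) :
    W.selmerInfty κ = datumSelmerInfty κ (W.geomPrimaryTorsion p) L ∅ := by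
  rw [selmerInfty_eq_gvSelmerInfty W p κ hp2 hκ L hRD]
  rfl

end Summit.BirchSwinnertonDyer.Rank1Residual.Additive

end
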